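import Literature.AnabelianGeometry.EtaleTheta.SettingModelChiSectionPoints
import Literature.AnabelianGeometry.EtaleTheta.SettingModelChiCyclotomes
import Literature.AnabelianGeometry.EtaleTheta.Discharge.Sec1Prop15iiOfCoreSection
import HarnessLib

/-!
# The χ-twisted root model of [EtTh] §1: Prop. 1.5 (i) AND (ii) HOLD for the section Kummer datum
# (`Prop15i (kummerDataχSec p)`, `Prop15ii (kummerDataχSec p)` — FACT-LIST rows F-2502 / F-2503 at `modelχ`)

Mochizuki, *The étale theta function …*, Publ. RIMS **45** (2009) [EtTh], §1, Prop. 1.5 "(Theta Cohomology)",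
PRIMS PDF p. 23 [cite: MochizukiEtTh2009, Prop 1.5 p.23]: "`F⁰/F¹ = Hom(Δ_Θ, Δ_Θ) = Ẑ·log(Θ)`; `F¹/F² = … =
Ẑ·log(U)`; `F² = H¹(G_K, Δ_Θ) →̃ (K^×)^∧`", and (ii) the same on `Ÿ` "where we write `log(Ü) := ½·log(U)`".

PROOF-ONLY file (abc-iut cell, layer L2, row R179/R184 of abc-iut-L2-lead «F-2503 Prop 1.5 (ii) FACTS → THEOREMS at
the t8 §1–§2 model»; seat abc-iut-L6-d5 gen 4; no definition, no instance, no `Prop` fact). Over the R78 cluster's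
χ-twisted root model `ThetaSetting.modelχ p` (abc-iut-L2-t1, F5b), abc-iut-w5-d171's Kummer core `kummerCoreχ` with
its coordinate classes `logUχ`, `logUddχ` (F6), abc-iut-L2-t6's SECTION datum `kummerDataχSec p` (F7: carriers
`H¹(G_K, Δ_Θ)`, `H¹(G_K̈, Δ_Θ)` through the Galois factor `inr`), abc-iut-L6-d6's `Ẑ`-coordinate `deltaThetaCoordχ`
of the theta centre (F1c) and this seat's root theorems `Sec1Prop15iiOfCoreSection` — all consumed BY NAME:

* clause (b): `yThetaχ_eq_one_of_mem_deltaTheta` — the `y`-coordinate crossed homomorphism VANISHES on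
  `Δ_Θ = c^Ẑ` (`ĥ_N(c^t) = (0,0,t)`), hence **`logUχ_mem_F1`**, **`logUddχ_mem_Fdd1`** (`log(U) ∈ F¹`, `log(Ü) ∈ F̈¹`);
* clause (a): **`exists_res_eq_logTheta_gtpY_modelχ`** — ONE lift of `log(Θ)` to `H¹((Π^tp_Y)^Θ, Δ_Θ)`: the class of
  the `z`-COORDINATE crossed homomorphism `h ↦ c^{ẑ(h)}`, where `ẑ : F̂₂ → Ẑ` has levels `ĥ_N(·).z` (continuous:
  locally constant levels), is ADDITIVE on `Ker ê = {x = 0}` (the Heisenberg law `z(ww') = z + z' + x·y'`), twists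
  through `χ` (`ĥ_N(θ_φ w).z = χ_N(φ)·ĥ_N(w).z`), descends to `(Π^tp_X)^Θ` and is the identity on `c^t`; by the root
  theorems (`KummerCore.res_deltaTheta_surjective_of_res_eq_logTheta`: the power-limit binder is discharged from
  the core) restriction `H¹((Π^tp_Y)^Θ, Δ_Θ) → Hom(Δ_Θ, Δ_Θ)` is SURJECTIVE, on `Y` and on `Ÿ`;
* clause (c) is abc-iut-w5-d140's `Fdd2_eq_range_kumYdd_of_section` / this seat's `F2_eq_range_kumY_ofSection`;
* assembly: **`prop15i_kummerDataχSec`**, **`prop15ii_kummerDataχSec`** (for every `hC : Compat`), and the census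
  form `exists_kummerData_prop15i_and_prop15ii_modelχ : ∃ E, Prop15i E _ ∧ Prop15ii E _` at a setting with
  `IsEtThOrigin` — the typed Prop. 1.5 (i)/(ii) are NON-VACUOUSLY SATISFIABLE (contrast: at the untwisted root
  `model p` they hold vacuously, `KummerData` being empty there — abc-iut-f-117).

HONEST FRAMING: SEMI-SYNTHETIC model (the χ-twisted root, «split-Tate»); consistency / non-vacuity evidence for the
typed interface ONLY; nothing of [EtTh] is asserted; typed ≠ proved; no side is taken on [IUTchIII] Cor. 3.12.
-/

noncomputable section

open CategoryTheory ProfiniteGrp ProfiniteGrp.ProfiniteCompletion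

namespace Literature.AnabelianGeometry.EtaleTheta.SettingModel

open Literature.AnabelianGeometry.SemiGraphs _root_.Topology _root_.Function
open scoped IsMulCommutative commutatorElement

variable (p : ℕ) [Fact p.Prime]

/-! ### Clause (b): the coordinate classes die on `Δ_Θ` -/

/-- **The `y`-coordinate vanishes on the theta centre**: `ŷ(c^t) = 0`, i.e. `yThetaχ d = 1` for `d ∈ Δ_Θ(modelχ)`
(`d = c^t` and `ĥ_N(c^t) = (0, 0, t mod N)` at every level). [cite: MochizukiEtTh2009, Prop 1.5 (ii) p.23] -/
theorem yThetaχ_eq_one_of_mem_deltaTheta {d : CurveTheta.GTheta (curveχ p)}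
    (hd : d ∈ (CurveTheta.thetaToEll (curveχ p)).ker) : yThetaχ p d = 1 := by
  obtain ⟨t, rfl⟩ := exists_cThetaχ_eq_of_mem_ker p hd
  rw [cThetaχ_apply, yThetaχ_toTheta]
  refine ext_of_modN fun N => ?_
  rw [map_one]
  apply (hHat_y_eq_zero_iff N _).mp
  rw [hHat_eq_of_toTheta_eq_cThetaχ p (cThetaχ_apply p t).symm N]

/-- `Δ_Θ(modelχ)` acts trivially on itself (it is commutative). [cite: MochizukiEtTh2009, §1 p.12] -/
theorem conjNormal_eq_of_mem_deltaTheta_modelχ :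
    ∀ n ∈ (ThetaSetting.modelχ p).DeltaTheta, ∀ a : (ThetaSetting.modelχ p).DeltaTheta,
      MulAut.conjNormal (MonoidHom.id (ThetaSetting.modelχ p).GtpTheta n) a = a := by
  intro n hn a
  apply Subtype.ext
  rw [MulAut.conjNormal_apply, MonoidHom.id_apply,
    ← (ThetaSetting.modelχ p).ker_thetaToEll_comm a.1 a.2 n hn, mul_inv_cancel_right]

/-- **`log(U) ∈ F¹` at `modelχ`** (clause (i)(b) of Prop. 1.5 HOLDS for the core's `log(U)`): the `y`-coordinate
cocycle vanishes on `Δ_Θ` on the nose. [cite: MochizukiEtTh2009, Prop 1.5 (i) p.23] -/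
theorem logUχ_mem_F1 (hC : (ThetaSetting.modelχ p).Compat) : logUχ p ∈ ThetaSetting.F1 hC := by
  refine (ContH1.res_mk_eq_one_iff_of_conj_trivial _ (conjNormal_eq_of_mem_deltaTheta_modelχ p) _ _).mpr
    fun n => ?_
  show deltaThetaCoordχ p (yThetaχ p n.1) = 1
  rw [yThetaχ_eq_one_of_mem_deltaTheta p n.2, map_one]

/-- **`log(Ü) ∈ F̈¹` at `modelχ`** (clause (ii)(b) of Prop. 1.5 HOLDS for the core's `log(Ü)`).
[cite: MochizukiEtTh2009, Prop 1.5 (ii) p.23] -/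
theorem logUddχ_mem_Fdd1 (hC : (ThetaSetting.modelχ p).Compat) : logUddχ p ∈ ThetaSetting.Fdd1 hC := by
  refine (ContH1.res_mk_eq_one_iff_of_conj_trivial _ (conjNormal_eq_of_mem_deltaTheta_modelχ p) _ _).mpr
    fun n => ?_
  show deltaThetaCoordχ p (half ⟨yThetaχ p n.1, _⟩) = 1
  have h1 : (⟨yThetaχ p n.1, yThetaχ_mem_range_sqHom p ((hC.deltaTheta_le_DtpYddTheta.trans
      (Subgroup.map_mono inf_le_left)) n.2)⟩ : sqHom.range) = 1 :=
    Subtype.ext (yThetaχ_eq_one_of_mem_deltaTheta p n.2)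
  rw [h1, map_one, map_one]

/-! ### Clause (a): the `z`-coordinate lift of `log(Θ)` to `(Π^tp_Y)^Θ` -/

/-- **A lift of `log(Θ)` to `H¹((Π^tp_Y)^Θ, Δ_Θ)` at `modelχ`**: the class of the `z`-coordinate crossed
homomorphism `h ↦ c^{ẑ(h)}` on `(Π^tp_Y)^Θ` restricts to the identity `log(Θ)` on `Δ_Θ = c^Ẑ` — the group side
of "a class … that maps to `log(Θ)`" (Prop. 1.5, p. 23), already on `Y` at this split model (cf. Rmk. 1.3.1).
[cite: MochizukiEtTh2009, Prop 1.5 (iii) p.23] -/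
theorem exists_res_eq_logTheta_gtpY_modelχ
    (hle : (ThetaSetting.modelχ p).DeltaTheta ≤
      (ThetaSetting.modelχ p).GtpY.map (ThetaSetting.modelχ p).toTheta) :
    ∃ x : (ThetaSetting.modelχ p).H1Theta ((ThetaSetting.modelχ p).GtpY.map (ThetaSetting.modelχ p).toTheta),
      ContH1.res (MonoidHom.id (ThetaSetting.modelχ p).GtpTheta) (ThetaSetting.modelχ p).DeltaTheta hle x =
        (ThetaSetting.modelχ p).logTheta := by
  -- (1) the `Ẑ`-valued `z`-coordinate on `F̂₂`, levelwise `ĥ_N(·).z`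
  choose zC hzC using fun w : F₂hatT => exists_zHat_forall_hHat_z_eq w
  have hzext : ∀ {w : F₂hatT} {t : ZH},
      (∀ N : ℕ+, (hHat N w).z = Multiplicative.toAdd (modN N t)) → zC w = t :=
    fun h => ext_of_modN fun N => Multiplicative.toAdd.injective (by rw [hzC, h N])
  -- continuity: the levels are locally constant
  have hcont : Continuous zC := by
    refine ZHatLevel.continuous_of_isLocallyConstant_level zC fun N => ?_
    have heq : (fun w : F₂hatT => ZHatLevel.level N (zC w)) = fun w => Multiplicative.ofAdd (hHat N w).z := by
      funext w
      rw [← modN_eq_level, ← hzC w N, ofAdd_toAdd]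
    rw [heq]
    exact ((IsLocallyConstant.iff_continuous _).2 (hHat N).continuous).comp fun h => Multiplicative.ofAdd h.z
  -- the Heisenberg law `z(ww') = z(w) + z(w') + x(w)·y(w')`: additive on `Ker ê`, and blind to level-trivial `w'`
  have hmul : ∀ w w' : F₂hatT, eHat w = 1 → zC (w * w') = zC w * zC w' := by
    intro w w' hw
    refine hzext fun N => ?_
    rw [map_mul (modN N), toAdd_mul, hzC w N, hzC w' N, map_mul (hHat N)]
    show (hHat N w).z + (hHat N w').z + (hHat N w).x * (hHat N w').y = _
    rw [hHat_x_eq_zero_of_eHat_eq_one N hw, zero_mul, add_zero]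
  have hker : ∀ w w' : F₂hatT, (∀ N : ℕ+, hHat N w' = 1) → zC (w * w') = zC w := fun w w' h =>
    hzext fun N => by rw [map_mul (hHat N), h N, mul_one, hzC]
  -- the twist acts on `z` through `χ`
  have htw : ∀ (φ : MulAut ZH) (w : F₂hatT), zC (twist φ w) = φ (zC w) := by
    intro φ w
    refine hzext fun N => ?_
    rw [hHat_twist_z, modN_eq_level, ZHatLevel.toAdd_level_aut, ← modN_eq_level, hzC]
  -- `z(c^t) = t`
  have hc : ∀ t : ZH, zC (powHat (eta ⁅FreeGroup.of (0 : Fin 2), FreeGroup.of 1⁆) t) = t := fun t =>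
    hzext fun N => by rw [hHat_powHat_commutator, modN_eq_level]
  -- (2) descent to `(Π^tp_X)^Θ = Π^tp_X / Ker`: `Ker` is level-trivial with trivial Galois component
  obtain ⟨zT, hzT, hzTc⟩ : ∃ zT : CurveTheta.GTheta (curveχ p) → ZH,
      (∀ g : PiTpχ p, zT (CurveTheta.toTheta (curveχ p) g) = zC (gfpFst g.left)) ∧ Continuous zT := by
    refine ⟨Quotient.lift (fun g : PiTpχ p => zC (gfpFst g.left)) ?_, fun g => rfl, ?_⟩
    · intro a b hab
      have hab' : a⁻¹ * b ∈ CurveTheta.thetaKer (curveχ p) := QuotientGroup.leftRel_apply.mp hab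
      show zC (gfpFst a.left) = zC (gfpFst b.left)
      conv_rhs => rw [← mul_inv_cancel_left a b]
      rw [SemidirectProduct.mul_left, map_mul, gfpFst_actχ, actHatχ_apply]
      exact (hker _ _ fun N => by rw [hHat_twist, ((mem_thetaKerχ_iff p _).mp hab').1 N, map_one]).symm
    · exact (QuotientGroup.isQuotientMap_mk (CurveTheta.thetaKer (curveχ p))).continuous_iff.mpr
        (hcont.comp (gfpFst.continuous.comp (Semidirect.continuous_left (isInducing_leftRightχ p))))
  -- on `Π^tp_Y = Ker(Π^tp_X ↠ Z)` the `a`-exponent vanishes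
  have heY : ∀ g : PiTpχ p, g ∈ (ThetaSetting.modelχ p).GtpY → eHat (gfpFst g.left) = 1 := by
    intro g hg
    have h1 : gfpSnd g.left = 1 := hg
    rw [gfpFst_apply, (mem_Gfp _).mp g.left.2]
    change iotaZ (gfpSnd g.left) = 1
    rw [h1, map_one]
  -- the crossed law `ẑ(xy) = ẑ(x) · χ(aug^Θ x)(ẑ(y))` on `(Π^tp_Y)^Θ`
  have hlaw : ∀ x y : ↥((ThetaSetting.modelχ p).GtpY.map (ThetaSetting.modelχ p).toTheta),
      zT ((x : CurveTheta.GTheta (curveχ p)) * y) =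
        zT x * chi p (CurveTheta.augTheta (curveχ p) x) (zT y) := by
    rintro ⟨_, g, hg, rfl⟩ ⟨_, h, -, rfl⟩
    show zT (CurveTheta.toTheta (curveχ p) g * CurveTheta.toTheta (curveχ p) h) =
      zT (CurveTheta.toTheta (curveχ p) g) *
        chi p (CurveTheta.augTheta (curveχ p) (CurveTheta.toTheta (curveχ p) g)) (zT (CurveTheta.toTheta (curveχ p) h))
    rw [← map_mul, hzT, hzT, hzT, CurveTheta.augTheta_toTheta, SemidirectProduct.mul_left, map_mul, gfpFst_actχ,
      actHatχ_apply, hmul _ _ (heY g hg), htw]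
    rfl
  -- (3) the cocycle `h ↦ c^{ẑ(h)}` on `(Π^tp_Y)^Θ`
  let f : ↥((ThetaSetting.modelχ p).GtpY.map (ThetaSetting.modelχ p).toTheta) →
      (CurveTheta.thetaToEll (curveχ p)).ker := fun h => deltaThetaCoordχ p (zT h)
  have hf : f ∈ contCocycles (MonoidHom.id (CurveTheta.GTheta (curveχ p))) (CurveTheta.thetaToEll (curveχ p)).ker
      ((ThetaSetting.modelχ p).GtpY.map (ThetaSetting.modelχ p).toTheta) := by
    refine ⟨(continuous_deltaThetaCoordχ p).comp (hzTc.comp continuous_subtype_val), fun x y => ?_⟩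
    show deltaThetaCoordχ p (zT ((x : CurveTheta.GTheta (curveχ p)) * y)) =
      deltaThetaCoordχ p (zT x) *
        MulAut.conjNormal ((MonoidHom.id _) (x : CurveTheta.GTheta (curveχ p))) (deltaThetaCoordχ p (zT y))
    rw [hlaw, map_mul, MonoidHom.id_apply, ← deltaThetaCoordχ_chi]
  refine ⟨ContH1.mk f hf, ?_⟩
  -- (4) its restriction to `Δ_Θ = c^Ẑ` is the identity: `ẑ(c^t) = t`
  change ContH1.mk (fun d => f ⟨d.1, hle d.2⟩) (ContH1.resCocycle _ _ hle ⟨f, hf⟩).2 = ContH1.mk _ _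
  refine ContH1.mk_congr _ (funext fun d => ?_) _ _
  obtain ⟨t, ht⟩ := exists_cThetaχ_eq_of_mem_ker p d.2
  apply Subtype.ext
  show ((deltaThetaCoordχ p (zT d.1) : (CurveTheta.thetaToEll (curveχ p)).ker) : CurveTheta.GTheta (curveχ p)) = d.1
  rw [← ht, cThetaχ_apply, hzT, SemidirectProduct.left_inl, gfpFst_cGfpχ, hc, coe_deltaThetaCoordχ, cThetaχ_apply]

/-- The same lift on `Ÿ`: a class of `H¹((Π^tp_Ÿ)^Θ, Δ_Θ)` restricting to `log(Θ)` (restrict the `Y`-lift).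
[cite: MochizukiEtTh2009, Prop 1.5 (iii) p.23] -/
theorem exists_res_eq_logTheta_gtpYdd_modelχ
    (hle : (ThetaSetting.modelχ p).DeltaTheta ≤
      (ThetaSetting.modelχ p).GtpYdd.map (ThetaSetting.modelχ p).toTheta) :
    ∃ x : (ThetaSetting.modelχ p).H1Theta ((ThetaSetting.modelχ p).GtpYdd.map (ThetaSetting.modelχ p).toTheta),
      ContH1.res (MonoidHom.id (ThetaSetting.modelχ p).GtpTheta) (ThetaSetting.modelχ p).DeltaTheta hle x =
        (ThetaSetting.modelχ p).logTheta := by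
  obtain ⟨x, hx⟩ := exists_res_eq_logTheta_gtpY_modelχ p (hle.trans (ThetaSetting.modelχ p).GtpYddTheta_le)
  exact ⟨ContH1.res _ _ (ThetaSetting.modelχ p).GtpYddTheta_le x, (ContH1.res_res _ _ x).trans hx⟩

/-- **Clause (a) of Prop. 1.5 (i) HOLDS at `modelχ`**: restriction `H¹((Π^tp_Y)^Θ, Δ_Θ) → Hom(Δ_Θ, Δ_Θ)` is
SURJECTIVE ("`F⁰/F¹ = Hom(Δ_Θ, Δ_Θ)`") — one lift of `log(Θ)` plus the root theorem
`KummerCore.res_deltaTheta_surjective_of_res_eq_logTheta` for `kummerCoreχ`. [cite: MochizukiEtTh2009, Prop 1.5 (i) p.23] -/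
theorem res_deltaTheta_surjective_gtpY_modelχ
    (hle : (ThetaSetting.modelχ p).DeltaTheta ≤
      (ThetaSetting.modelχ p).GtpY.map (ThetaSetting.modelχ p).toTheta) :
    Surjective (ContH1.res (MonoidHom.id (ThetaSetting.modelχ p).GtpTheta) (ThetaSetting.modelχ p).DeltaTheta hle :
      (ThetaSetting.modelχ p).H1Theta ((ThetaSetting.modelχ p).GtpY.map (ThetaSetting.modelχ p).toTheta) →
        (ThetaSetting.modelχ p).H1Theta (ThetaSetting.modelχ p).DeltaTheta) := by
  haveI : T2Space (ThetaSetting.modelχ p).GtpTheta := CurveTheta.t2Space_GTheta (curveχ p)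
  obtain ⟨x, hx⟩ := exists_res_eq_logTheta_gtpY_modelχ p hle
  exact (kummerCoreχ p).res_deltaTheta_surjective_of_res_eq_logTheta hle x hx

/-- **Clause (a) of Prop. 1.5 (ii) HOLDS at `modelχ`**: restriction `H¹((Π^tp_Ÿ)^Θ, Δ_Θ) → Hom(Δ_Θ, Δ_Θ)` is
SURJECTIVE ("`F̈⁰/F̈¹ = Hom(Δ_Θ, Δ_Θ)`"). [cite: MochizukiEtTh2009, Prop 1.5 (ii) p.23] -/
theorem res_deltaTheta_surjective_gtpYdd_modelχ
    (hle : (ThetaSetting.modelχ p).DeltaTheta ≤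
      (ThetaSetting.modelχ p).GtpYdd.map (ThetaSetting.modelχ p).toTheta) :
    Surjective (ContH1.res (MonoidHom.id (ThetaSetting.modelχ p).GtpTheta) (ThetaSetting.modelχ p).DeltaTheta hle :
      (ThetaSetting.modelχ p).H1Theta ((ThetaSetting.modelχ p).GtpYdd.map (ThetaSetting.modelχ p).toTheta) →
        (ThetaSetting.modelχ p).H1Theta (ThetaSetting.modelχ p).DeltaTheta) := by
  haveI : T2Space (ThetaSetting.modelχ p).GtpTheta := CurveTheta.t2Space_GTheta (curveχ p)
  obtain ⟨x, hx⟩ := exists_res_eq_logTheta_gtpYdd_modelχ p hle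
  exact (kummerCoreχ p).res_deltaTheta_surjective_of_res_eq_logTheta hle x hx

/-! ### Assembly: Prop. 1.5 (i) and (ii) for the section datum `kummerDataχSec` -/

/-- **[EtTh] Prop. 1.5 (i) HOLDS for the section Kummer datum of the χ-model** — all three clauses:
`F⁰/F¹ = Hom(Δ_Θ, Δ_Θ)` (the `z`-lift), `log(U) ∈ F¹` (the `y`-class dies on `Δ_Θ`), `F² = range kumY`
(inflation–restriction through the section). FACT-LIST row F-2502 as a THEOREM at `modelχ`.
[cite: MochizukiEtTh2009, Prop 1.5 (i) p.23] -/
theorem prop15i_kummerDataχSec (hC : (ThetaSetting.modelχ p).Compat) : ThetaSetting.Prop15i (kummerDataχSec p) hC :=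
  ⟨res_deltaTheta_surjective_gtpY_modelχ p _, logUχ_mem_F1 p hC,
    (kummerCoreχ p).F2_eq_range_kumY_ofSection _ (continuous_inr_modelχ p) (aug_modelχ_inr p)
      (map_inr_GK_le_GtpY_modelχ p) (map_inr_GKdd_le_GtpYdd_modelχ p)⟩

/-- **[EtTh] Prop. 1.5 (ii) HOLDS for the section Kummer datum of the χ-model** — all three clauses:
`F̈⁰/F̈¹ = Hom(Δ_Θ, Δ_Θ)`, `log(Ü) ∈ F̈¹`, `F̈² = range kumYdd` (abc-iut-w5-d140's `prop15ii_of_section`).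
FACT-LIST row F-2503 as a THEOREM at `modelχ`. [cite: MochizukiEtTh2009, Prop 1.5 (ii) p.23] -/
theorem prop15ii_kummerDataχSec (hC : (ThetaSetting.modelχ p).Compat) :
    ThetaSetting.Prop15ii (kummerDataχSec p) hC :=
  (kummerCoreχ p).prop15ii_of_section _ (continuous_inr_modelχ p) (aug_modelχ_inr p)
    (map_inr_GK_le_GtpY_modelχ p) (map_inr_GKdd_le_GtpYdd_modelχ p) hC
    (res_deltaTheta_surjective_gtpYdd_modelχ p _) (logUddχ_mem_Fdd1 p hC)

/-- **Census form**: at the χ-twisted root model — a theta setting satisfying `IsEtThOrigin` — there is a Kummer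
datum for which BOTH typed rows `Prop15i` (F-2502) and `Prop15ii` (F-2503) HOLD: the rows are NON-VACUOUSLY
satisfiable (contrast: at the untwisted root `model p` they hold vacuously, `KummerData` being empty).
[cite: MochizukiEtTh2009, Prop 1.5 p.23] -/
theorem exists_kummerData_prop15i_and_prop15ii_modelχ :
    ∃ E : (ThetaSetting.modelχ p).KummerData,
      ThetaSetting.Prop15i E (ThetaSetting.modelχ p).compat ∧ ThetaSetting.Prop15ii E (ThetaSetting.modelχ p).compat :=
  ⟨kummerDataχSec p, prop15i_kummerDataχSec p _, prop15ii_kummerDataχSec p _⟩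

/-- **Joint satisfiability with the guard**: some theta setting satisfies `IsEtThOrigin` and carries a Kummer datum
with `Prop15i` and `Prop15ii` (witness `modelχ`, `kummerDataχSec`). [cite: MochizukiEtTh2009, Prop 1.5 p.23] -/
theorem _root_.Literature.AnabelianGeometry.EtaleTheta.ThetaSetting.exists_isEtThOrigin_and_prop15i_and_prop15ii :
    ∃ D : ThetaSetting p, D.IsEtThOrigin ∧ ∃ E : D.KummerData,
      ThetaSetting.Prop15i E D.compat ∧ ThetaSetting.Prop15ii E D.compat :=
  ⟨ThetaSetting.modelχ p, ThetaSetting.modelχ_isEtThOrigin p, exists_kummerData_prop15i_and_prop15ii_modelχ p⟩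

end Literature.AnabelianGeometry.EtaleTheta.SettingModel

end
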